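import Summits.KontsevichZagierPeriods.KontsevichZagierPeriods.Theorems.TerasomaMultiplicationBetaCancellationStubTameFormAux1
import Summits.KontsevichZagierPeriods.KontsevichZagierPeriods.Theorems.TerasomaMultiplicationBetaCancellationStubTameFormAux3

/-!
# `BetaCancellation` (stmt-KontsevichZagierPeriods-13633), line `divisor-slicing-transshipment` — stub `stub_tameForm`, auxiliary file 4: inversion of `MIso`

**Symmetry of finite piecewise measure isomorphisms** (`MIso.symm`): if the source densities are
positive on the source slots, an `MIso N σ ρ τ θ` can be inverted up to null sets. On each piece
`P` the map `Ψ` is injective with Jacobian of non-zero determinant (positivity of the densities and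
the measure-preservation identity); its inverse `g = Ψ⁻¹ : Ψ(P) → P` is a `ℚ`-semialgebraic map, hence
smooth on an open `ℚ`-semialgebraic `G ⊆ Ψ(P)` with null complement
(`exists_isOpen_contDiffOn_map`); on `G` the chain rule for `Ψ ∘ g = id` gives
`det Ψ'(g y) · det g'(y) = 1`, so `(G, g, g')` is a piece of the inverse isomorphism, and the part
of `P` not reached, `P ∩ Ψ⁻¹(Ψ(P) ∖ G)`, is null by the area formula (`volume_inter_preimage_null`).

References: J. Bochnak, M. Coste, M.-F. Roy, *Real Algebraic Geometry* (1998), §2.9;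
Mathlib `MeasureTheory.lintegral_abs_det_fderiv_eq_addHaar_image`.
-/

noncomputable section

-- `Summit.KontsevichZagierPeriods.KontsevichZagierPeriods.…` is the tree's mandated layout (single-conjunct summit).
set_option linter.dupNamespace false

namespace Summit.KontsevichZagierPeriods.KontsevichZagierPeriods.BetaCancellationDivisorSlicing

open MeasureTheory Set Filter Function
open scoped Topology ContDiff
open Literature.NumberTheory.Transcendental
open Literature.NumberTheory.Transcendental.KZ
open Literature.ModelTheory.ExponentialFields (IsSemialgebraic isSemialgebraic_univ)

namespace MIso

variable {N : ℕ} {ι κ : Type*} {σ : ι → Set (Fin N → ℝ)} {ρ : ι → (Fin N → ℝ) → ℝ}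
  {τ : κ → Set (Fin N → ℝ)} {θ : κ → (Fin N → ℝ) → ℝ}

/-- The determinant of a composite of continuous linear endomorphisms is the product of the
determinants. [folklore] -/
theorem det_comp' (A B : (Fin N → ℝ) →L[ℝ] (Fin N → ℝ)) : (A.comp B).det = A.det * B.det := by
  exact LinearMap.det_comp _ _

/-- **One inverted piece.** For a piece `(P, Ψ, Ψ')` of an `MIso` (semialgebraic, injective,
differentiable within `P`, Jacobian determinant nowhere zero on `P`) there is an open
`ℚ`-semialgebraic `G ⊆ Ψ(P)` with `Ψ(P) ∖ G` null and `P ∩ Ψ⁻¹(Ψ(P) ∖ G)` null, on which the inverse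
`g = Ψ⁻¹` is a `ℚ`-semialgebraic map with a derivative `g' y` satisfying `Ψ'(g y) ∘ g'(y) = id`.
[cite: BochnakCosteRoy1998, §2.9] -/
theorem exists_inverse_piece {P : Set (Fin N → ℝ)} {Ψ : (Fin N → ℝ) → (Fin N → ℝ)}
    {Ψ' : (Fin N → ℝ) → ((Fin N → ℝ) →L[ℝ] (Fin N → ℝ))} (hP : IsSemialgebraic ℚ P)
    (hΨ : IsSemialgebraicMapOn ℚ P Ψ) (hinj : InjOn Ψ P)
    (hΨ' : ∀ z ∈ P, HasFDerivWithinAt Ψ (Ψ' z) P z) (hdet : ∀ z ∈ P, (Ψ' z).det ≠ 0) :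
    ∃ (G : Set (Fin N → ℝ)) (g' : (Fin N → ℝ) → ((Fin N → ℝ) →L[ℝ] (Fin N → ℝ))),
      IsSemialgebraic ℚ G ∧ IsOpen G ∧ G ⊆ Ψ '' P ∧ volume (Ψ '' P \ G) = 0 ∧
      volume (P \ invFunOn Ψ P '' G) = 0 ∧
      IsSemialgebraicMapOn ℚ G (invFunOn Ψ P) ∧ InjOn (invFunOn Ψ P) G ∧
      (∀ y ∈ G, HasFDerivWithinAt (invFunOn Ψ P) (g' y) G y) ∧ invFunOn Ψ P '' G ⊆ P ∧
      (∀ y ∈ G, invFunOn Ψ P y ∈ P ∧ Ψ (invFunOn Ψ P y) = y ∧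
        (Ψ' (invFunOn Ψ P y)).comp (g' y) = ContinuousLinearMap.id ℝ _) := by
  set U := Ψ '' P with hU_def
  set g := invFunOn Ψ P with hg_def
  have hU : IsSemialgebraic ℚ U := IsSemialgebraicMapOn.isSemialgebraic_image_holds hΨ subset_rfl hP
  have hg : IsSemialgebraicMapOn ℚ U g := isSemialgebraicMapOn_invFunOn_image hΨ hinj
  have hgU : ∀ y ∈ U, g y ∈ P ∧ Ψ (g y) = y := fun y hy => invFunOn_pos ((mem_image _ _ _).mp hy)
  have hgΨ : ∀ x ∈ P, g (Ψ x) = x := fun x hx => hinj.leftInvOn_invFunOn hx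
  obtain ⟨G, hGU, hGo, hGsa, hGsm, -, hGnull⟩ := exists_isOpen_contDiffOn_map hU hg
  have hderiv : ∀ y ∈ G, HasFDerivAt g (fderiv ℝ g y) y := fun y hy =>
    ((hGsm y hy).differentiableAt (by simp)).hasFDerivAt
  -- the chain rule on `Ψ ∘ g = id` near `y ∈ G`
  have hchain : ∀ y ∈ G, (Ψ' (g y)).comp (fderiv ℝ g y) = ContinuousLinearMap.id ℝ _ := by
    intro y hy
    have hy' := hgU y (hGU hy)
    have h1 : HasFDerivWithinAt (Ψ ∘ g) ((Ψ' (g y)).comp (fderiv ℝ g y)) G y :=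
      (hΨ' (g y) hy'.1).comp y (hderiv y hy).hasFDerivWithinAt fun y' hy' => (hgU y' (hGU hy')).1
    have h2 : HasFDerivAt (Ψ ∘ g) ((Ψ' (g y)).comp (fderiv ℝ g y)) y :=
      h1.hasFDerivAt (hGo.mem_nhds hy)
    have h3 : HasFDerivAt (Ψ ∘ g) (ContinuousLinearMap.id ℝ _) y := by
      refine (hasFDerivAt_id y).congr_of_eventuallyEq ?_
      filter_upwards [hGo.mem_nhds hy] with y' hy'
      exact (hgU y' (hGU hy')).2
    exact h2.unique h3
  refine ⟨G, fun y => fderiv ℝ g y, hGsa, hGo, hGU, hGnull, ?_, hg.mono hGU hGsa, ?_,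
    fun y hy => (hderiv y hy).hasFDerivWithinAt, ?_, fun y hy => ⟨(hgU y (hGU hy)).1,
      (hgU y (hGU hy)).2, hchain y hy⟩⟩
  · -- the part of `P` not reached is `P ∩ Ψ⁻¹ (U ∖ G)`, null by the area formula
    have hset : P \ g '' G = P ∩ Ψ ⁻¹' (U \ G) := by
      ext x
      simp only [Set.mem_sdiff, mem_image, not_exists, not_and, mem_inter_iff, mem_preimage]
      constructor
      · rintro ⟨hx, h⟩
        exact ⟨hx, ⟨x, hx, rfl⟩, fun hΨx => h (Ψ x) hΨx (hgΨ x hx)⟩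
      · rintro ⟨hx, -, hΨx⟩
        refine ⟨hx, fun y hy hyx => hΨx ?_⟩
        rw [← hyx, (hgU y (hGU hy)).2]
        exact hy
    rw [hset]
    exact volume_inter_preimage_null hΨ' hinj hdet
      (Literature.ModelTheory.ExponentialFields.IsSemialgebraic.measurableSet_holds
        (isSemialgebraic_inter_preimage hΨ (hU.diff hGsa))) hGnull
  · intro y hy y' hy' h
    rw [← (hgU y (hGU hy)).2, ← (hgU y' (hGU hy')).2, h]
  · rintro _ ⟨y, hy, rfl⟩
    exact (hgU y (hGU hy)).1

/-- **Inversion of a finite piecewise measure isomorphism.** If the source densities are positive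
on the source slots, an `MIso N σ ρ τ θ` gives an `MIso N τ θ σ ρ` (invert each piece on the smooth
locus of the inverse map; the defects are null). [folklore] -/
theorem symm [Fintype ι] [Fintype κ] (m : MIso N σ ρ τ θ) (hρ : ∀ i, ∀ z ∈ σ i, 0 < ρ i z) :
    Nonempty (MIso N τ θ σ ρ) := by
  have hdet : ∀ j, ∀ z ∈ m.P j, (m.Ψ' j z).det ≠ 0 ∧ 0 < θ (m.tgt j) (m.Ψ j z) := fun j z hz =>
    det_ne_zero_of_density ((m.piece j).2.2.2.2.2.2 z hz) (hρ _ z ((m.piece j).2.1 hz))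
  choose G g' hGsa hGo hGU hGnull hPnull hg hginj hg' hgP hgy using fun j =>
    exists_inverse_piece (m.piece j).1 (m.piece j).2.2.1 (m.piece j).2.2.2.1 (m.piece j).2.2.2.2.1
      fun z hz => (hdet j z hz).1
  refine of_fintype m.tgt m.src G (fun j => invFunOn (m.Ψ j) (m.P j)) g' (fun j => ?_) ?_ ?_ ?_ ?_
  · obtain ⟨h1, h2, h3, h4, h5, h6, h7⟩ := m.piece j
    refine ⟨hGsa j, (hGU j).trans h6, hg j, hginj j, hg' j, (hgP j).trans h2, fun y hy => ?_⟩
    obtain ⟨hx, hΨx, hcomp⟩ := hgy j y hy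
    have hid := h7 _ hx
    rw [hΨx] at hid
    have hdet1 : (m.Ψ' j (invFunOn (m.Ψ j) (m.P j) y)).det * (g' j y).det = 1 := by
      rw [← det_comp', hcomp, ContinuousLinearMap.det, ContinuousLinearMap.coe_id, LinearMap.det_id]
    have habs : |(m.Ψ' j (invFunOn (m.Ψ j) (m.P j) y)).det| * |(g' j y).det| = 1 := by
      rw [← abs_mul, hdet1, abs_one]
    rw [hid, mul_assoc, habs, mul_one]
  · intro j j' hjj' h
    exact measure_mono_null (inter_subset_inter (hGU j) (hGU j')) (m.disjoint_tgt j j' hjj' h)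
  · intro j j' hjj' h
    exact measure_mono_null (inter_subset_inter ((hgP j).trans subset_rfl) (hgP j'))
      (m.disjoint_src j j' hjj' h)
  · intro k
    have hsub : τ k \ (⋃ (j) (_ : m.tgt j = k), G j) ⊆
        (τ k \ ⋃ (j) (_ : m.tgt j = k), m.Ψ j '' m.P j) ∪ ⋃ j, (m.Ψ j '' m.P j \ G j) := by
      intro y hy
      simp only [Set.mem_sdiff, mem_iUnion, exists_prop, not_exists, not_and, mem_union] at hy ⊢
      by_cases h : ∃ j, m.tgt j = k ∧ y ∈ m.Ψ j '' m.P j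
      · obtain ⟨j, hj, hyj⟩ := h
        exact Or.inr ⟨j, hyj, hy.2 j hj⟩
      · push Not at h
        exact Or.inl ⟨hy.1, h⟩
    exact measure_mono_null hsub (measure_union_null (m.cover_tgt k)
      (measure_iUnion_null_iff.mpr hGnull))
  · intro i
    have hsub : σ i \ (⋃ (j) (_ : m.src j = i), invFunOn (m.Ψ j) (m.P j) '' G j) ⊆
        (σ i \ ⋃ (j) (_ : m.src j = i), m.P j) ∪ ⋃ j, (m.P j \ invFunOn (m.Ψ j) (m.P j) '' G j) := by
      intro x hx
      simp only [Set.mem_sdiff, mem_iUnion, exists_prop, not_exists, not_and, mem_union] at hx ⊢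
      by_cases h : ∃ j, m.src j = i ∧ x ∈ m.P j
      · obtain ⟨j, hj, hxj⟩ := h
        exact Or.inr ⟨j, hxj, hx.2 j hj⟩
      · push Not at h
        exact Or.inl ⟨hx.1, h⟩
    exact measure_mono_null hsub (measure_union_null (m.cover_src i)
      (measure_iUnion_null_iff.mpr hPnull))

end MIso

/-! ### Headline -/

/-- Registered helper goal of the stub `stub_tameForm`: inversion of finite piecewise measure
isomorphisms with positive source densities. [folklore] -/
theorem tameForm_aux_misoSymm : ∀ {N : ℕ} {ι κ : Type} [Fintype ι] [Fintype κ] {σ : ι → Set (Fin N → ℝ)} {ρ : ι → (Fin N → ℝ) → ℝ} {τ : κ → Set (Fin N → ℝ)} {θ : κ → (Fin N → ℝ) → ℝ}, MIso N σ ρ τ θ → (∀ i, ∀ z ∈ σ i, 0 < ρ i z) → Nonempty (MIso N τ θ σ ρ) :=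
  fun m hρ => m.symm hρ

end Summit.KontsevichZagierPeriods.KontsevichZagierPeriods.BetaCancellationDivisorSlicing

end
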